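/-
Copyright (c) 2026 the pub-hodgecm-mathlib formalisation cell (harness21).  Prover seat hodgecm-mathlib-LH4-p04 (g4), Track A «(D-RAM) FOUR-FRAME», unit U2H, the census leaf
(ρ2b′-X) — payer LH4-p14 (g4) deal 05:51:49Z (T5c-O∕E): the PLUS-DEPTH facts behind the odd class of the RamM census (companion of `QuadraticOrderLevelCountsRamifiedNoTranslator`).  2026-09-04.
-/
import Literature.NumberTheory.LocalFields.WildQuadraticDatumTrace   -- ★ the ramified datum `(σ, ϖ, d, t)`: coordinates `a + bϖ`, parity splitting, `v_varpi_pow`, `d ≤ t + 1`, `Odd d ↔ d = t + 1`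
import HarnessLib

/-!
# PLUS-DEPTHS `|x + σx|` in a ramified quadratic datum `(σ, ϖ, d, t)`: odd valuation with `d ≤ t` gives `|x|·|ϖ|^{d−1}`, even valuation with `d = t + 1` gives `|x|·|ϖ|^{t}`;
# on a skew line `ι·u` the plus-depth is the minus-depth of `u`
(Serre, *Local Fields* Ch. I §6 Prop. 18, Ch. III §6 Prop. 13)

Topic `NumberTheory/LocalFields`; namespace `Literature.NumberTheory.LocalFields.WildQuadraticDatum` (= ★ `WildQuadraticDatumTrace`: `exists_fixed_coords_of_map_ne`,
`v_fixed_add_fixed_mul_eq_max`, `even_t`, `d_le_succ_t`, `odd_iff_eq_succ`).  THEOREMS ONLY (no definition, no instance, no notation, no named fact, no `sorry`); kernel lane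
`--supports stmt-HodgeConjecture-24833` (count-neutral).  Cell `pub/hodgecm-mathlib` (D-0151), crux H413, Track A, unit U2H, leaf (ρ2b′-X): in the RamM census the level condition
of a class `η′ = ρ(y₀)∕y₀` (`y₀` Θ-fixed, i.e. in the third field `K♮` with its ramified datum `(σ′, π′, d′, t′)`) is the PLUS-depth `|w + σ′w|`, `w = y₀·N(ω)`.  By ★ `odd_iff_eq_succ`
(`d′` odd ⟺ `d′ = t′ + 1`) the classes `v(y₀) ≢ d′ (mod 2)` are: `d′` even — odd valuation; `d′` odd — even valuation.  On them the plus-depth is CONSTANT `= |π′|^{d′−1}`: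
* **`v_add_map_eq_of_odd`** (`d ≤ t`, `|x| = exp(2n − 1)`): `|x + σx| = |x|·|ϖ|^{d−1}` — in Eisenstein coordinates `x = a + bϖ` the odd valuation is carried by `bϖ`, so
  `|x − σx| = |b|·|ϖ|^d = |x|·|ϖ|^{d−1}` exactly while `|2σx| = |x|·|ϖ|^t` is strictly smaller;
* **`v_add_map_eq_of_even`** (`d = t + 1`, `|x| = exp(2n)`): `|x + σx| = |x|·|ϖ|^t` — now `|x − σx| ≤ |x|·|ϖ|^d < |x|·|ϖ|^t = |2x|`;
* **`skew_mul_add_map`** ∕ **`v_skew_mul_add_map`** (`σι = −ι`): `ιu + σ(ιu) = ι(u − σu)` — on the classes `v(y₀) ≡ d′` (`y₀ = ι·u`) the plus-depth is the minus-depth of `u`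
  (the translator and non-norm ladders of the census).
So the odd class of the RamM census occupies exactly ONE level (K♮-depth `d′ − 1`) with all of `G_j` — the `k = −1` row of this seat's ★ p857711 letters.
HONEST LABEL: HC_CM is proved only modulo the 7 printed citations (2 remaining named inputs: hLiu418 = stmt-HodgeConjecture-24832, h413 = stmt-HodgeConjecture-24833) until rung 0
closes; unconditional local algebra, count-neutral.

## References
* [Serre1979] J.-P. Serre, *Local Fields*, GTM 67 (1979): Ch. I §6 Prop. 18 (`𝒪_E = 𝒪_F[π]` for a totally ramified extension), Ch. III §6 Prop. 13 (`𝒟 = (f′(π))`; the terms of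
  `f′(π) = 2π − Tr π` have distinct valuations mod `e`).
-/

set_option autoImplicit false

open WithZero

namespace Literature.NumberTheory.LocalFields.WildQuadraticDatum

variable {K' : Type*} [Field K'] [Valued K' ℤᵐ⁰] {σ' : K' →+* K'} {π' : K'} {d' t' : ℕ}

/-- **ODD VALUATION, `d′ ≤ t′`: `|x + σ′x| = |x|·|π′|^{d′−1}`** — in Eisenstein coordinates `x = a + bπ′` the odd valuation is carried by `bπ′`, so `|x − σ′x| = |b|·|π′|^{d′} =
|x|·|π′|^{d′−1}` exactly, and `|2σ′x| = |x|·|π′|^{t′}` is strictly smaller. [cite: Serre1979, Ch. III §6 Prop. 13] [cite: Serre1979, Ch. I §6 Prop. 18] -/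
theorem v_add_map_eq_of_odd (hσ' : ∀ x, σ' (σ' x) = x) (hvσ' : ∀ x, Valued.v (σ' x) = Valued.v x)
    (hfix' : ∀ x : K', σ' x = x → x ≠ 0 → ∃ n : ℤ, Valued.v x = exp (2 * n)) (hπ' : Valued.v π' = exp (-1 : ℤ))
    (hdd' : Valued.v (π' - σ' π') = Valued.v π' ^ d') (ht' : Valued.v (2 : K') = Valued.v π' ^ t') (hdt : d' ≤ t')
    {x : K'} {n : ℤ} (hx : Valued.v x = exp (2 * n - 1)) :
    Valued.v (x + σ' x) = Valued.v x * Valued.v π' ^ (d' - 1) := by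
  have hd1 : 1 ≤ d' := by
    by_contra h0
    have : d' = 0 := by omega
    subst this
    rw [pow_zero] at hdd'
    have hle : Valued.v (π' - σ' π') ≤ exp (-1 : ℤ) := (Valuation.map_sub _ _ _).trans (max_le hπ'.le (by rw [hvσ', hπ']))
    rw [hdd', ← exp_zero, exp_le_exp] at hle
    omega
  have hpow : Valued.v π' ^ d' = exp (-1 : ℤ) * Valued.v π' ^ (d' - 1) := by rw [← hπ', ← pow_succ', Nat.sub_add_cancel hd1]
  obtain ⟨a, b, ha, hb, rfl⟩ := exists_fixed_coords_of_map_ne hσ' (map_varpi_ne hπ' hdd') x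
  have hsplit := v_fixed_add_fixed_mul_eq_max (even_log_v_of_fixed hfix') hπ' ha hb
  -- the odd valuation is carried by `bπ′`
  have hbx : Valued.v (a + b * π') = Valued.v b * exp (-1 : ℤ) := by
    rcases le_total (Valued.v a) (Valued.v b * exp (-1 : ℤ)) with h | h
    · rw [hsplit, max_eq_right h]
    · exfalso
      have hva : Valued.v a = exp (2 * n - 1) := by rw [← hx, hsplit, max_eq_left h]
      have ha0 : a ≠ 0 := fun h0 => by rw [h0, map_zero] at hva; exact exp_ne_zero hva.symm
      obtain ⟨i, hi⟩ := hfix' a ha ha0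
      rw [hi, exp_inj] at hva; omega
  have hsub : Valued.v (a + b * π' - σ' (a + b * π')) = Valued.v (a + b * π') * Valued.v π' ^ (d' - 1) := by
    rw [show a + b * π' - σ' (a + b * π') = b * (π' - σ' π') by rw [map_add, map_mul, ha, hb]; ring, map_mul, hdd', hpow, hbx, mul_assoc]
  have hlt : Valued.v (2 * σ' (a + b * π')) < Valued.v (a + b * π' - σ' (a + b * π')) := by
    rw [hsub, map_mul, hvσ', ht', hx, v_varpi_pow hπ', v_varpi_pow hπ', ← exp_add, ← exp_add, exp_lt_exp]
    omega
  rw [show a + b * π' + σ' (a + b * π') = (a + b * π' - σ' (a + b * π')) + 2 * σ' (a + b * π') by ring, Valuation.map_add_eq_of_lt_left _ hlt, hsub]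

/-- **EVEN VALUATION, `d′ = t′ + 1`: `|x + σ′x| = |x|·|π′|^{t′}`** (`= |x|·|π′|^{d′−1}`) — now `|x − σ′x| ≤ |x|·|π′|^{d′}` is strictly below `|2x| = |x|·|π′|^{t′}`.
[cite: Serre1979, Ch. III §6 Prop. 13] [cite: Serre1979, Ch. I §6 Prop. 18] -/
theorem v_add_map_eq_of_even (hσ' : ∀ x, σ' (σ' x) = x)
    (hfix' : ∀ x : K', σ' x = x → x ≠ 0 → ∃ n : ℤ, Valued.v x = exp (2 * n)) (hπ' : Valued.v π' = exp (-1 : ℤ))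
    (hdd' : Valued.v (π' - σ' π') = Valued.v π' ^ d') (ht' : Valued.v (2 : K') = Valued.v π' ^ t') (hdt : d' = t' + 1)
    {x : K'} {n : ℤ} (hx : Valued.v x = exp (2 * n)) :
    Valued.v (x + σ' x) = Valued.v x * Valued.v π' ^ t' := by
  obtain ⟨a, b, ha, hb, rfl⟩ := exists_fixed_coords_of_map_ne hσ' (map_varpi_ne hπ' hdd') x
  have hsplit := v_fixed_add_fixed_mul_eq_max (even_log_v_of_fixed hfix') hπ' ha hb
  -- `|b| ≤ |x|` (the parities differ, so `|b|·|π′| < |x|`)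
  have hble : Valued.v b ≤ Valued.v (a + b * π') := by
    rcases eq_or_ne b 0 with rfl | hb0
    · rw [map_zero]; exact zero_le
    obtain ⟨k, hk⟩ := hfix' b hb hb0
    have hle : Valued.v b * exp (-1 : ℤ) ≤ Valued.v (a + b * π') := by rw [hsplit]; exact le_max_right _ _
    rw [hk, hx, ← exp_add, exp_le_exp] at hle
    rw [hk, hx, exp_le_exp]; omega
  have hsub : Valued.v (a + b * π' - σ' (a + b * π')) ≤ Valued.v (a + b * π') * Valued.v π' ^ d' := by
    rw [show a + b * π' - σ' (a + b * π') = b * (π' - σ' π') by rw [map_add, map_mul, ha, hb]; ring, map_mul, hdd']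
    exact mul_le_mul' hble le_rfl
  have h2x : Valued.v (2 * (a + b * π')) = Valued.v (a + b * π') * Valued.v π' ^ t' := by rw [map_mul, ht', mul_comm]
  have hx0 : 0 < Valued.v (a + b * π') := by rw [hx]; exact zero_lt_iff.2 exp_ne_zero
  have hπ0 : 0 < Valued.v π' := by rw [hπ']; exact zero_lt_iff.2 exp_ne_zero
  have hlt : Valued.v (-(a + b * π' - σ' (a + b * π'))) < Valued.v (2 * (a + b * π')) := by
    rw [Valuation.map_neg, h2x]
    refine lt_of_le_of_lt hsub ?_
    rw [hdt, pow_succ, ← mul_assoc]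
    exact mul_lt_of_lt_one_right (mul_pos hx0 (pow_pos hπ0 _)) (by rw [hπ', ← exp_zero, exp_lt_exp]; norm_num)
  rw [show a + b * π' + σ' (a + b * π') = 2 * (a + b * π') + -(a + b * π' - σ' (a + b * π')) by ring, Valuation.map_add_eq_of_lt_left _ hlt, h2x]

omit [Valued K' ℤᵐ⁰] in
/-- **THE SKEW LINE: `ι·u + σ′(ι·u) = ι·(u − σ′u)`** for a skew element `σ′ι = −ι` — on the classes `ι·(units)` the plus-depth is the minus-depth of `u` (translator and non-norm
ladders). [cite: Serre1979, Ch. III §6 Prop. 13] -/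
theorem skew_mul_add_map (σ' : K' →+* K') {ι : K'} (hι : σ' ι = -ι) (u : K') : ι * u + σ' (ι * u) = ι * (u - σ' u) := by
  rw [map_mul, hι]; ring

/-- `|ι·u + σ′(ι·u)| = |ι|·|u − σ′u|` for a skew element `σ′ι = −ι`. [cite: Serre1979, Ch. III §6 Prop. 13] -/
theorem v_skew_mul_add_map (σ' : K' →+* K') {ι : K'} (hι : σ' ι = -ι) (u : K') :
    Valued.v (ι * u + σ' (ι * u)) = Valued.v ι * Valued.v (u - σ' u) := by
  rw [skew_mul_add_map σ' hι, map_mul]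

end Literature.NumberTheory.LocalFields.WildQuadraticDatum
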